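import Literature.MathematicalPhysics.QuantumFieldTheory.BalabanJaffe1986.BJ86CouplingRenormalization

/-!
# Beta / EriceFlowEnclosureBareSums — elementary summation lemmas for the two-loop asymptotics (3.76) of the bare
# coupling (β-flow team, prover 2 = lower-bound ∕ positivity side, unit `b2b-balaban-beta-bflow-p2`, gen 4; file 1 of 3:
# `…BareSums` → `…BareRun` → `…BareAsymptotics`)

HONEST FRAMING (page 1 of everything the β sub-cell writes): discharging `BetaPertH` makes Bałaban's UV stability
UNCONDITIONAL — a real constructive-QFT result; it is NOT the continuum limit and NOT the Clay problem.  HONEST DEPENDENCY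
(cell reorg 2026-08-19, verbatim): «continuum YM on T⁴ ⇐ BetaPertH ∧ nine spine estimates (0/9 proved); BetaPertH ⇐ (D1) ∧
(D4) ∧ CAP+tail; G-an2-4 gates asym, D1 and NE2/3/4.»  THIS MODULE IS PURE REAL ANALYSIS: no Erice
sentence and no Bałaban object occurs in a statement except the typed SHAPE `TaylorSplit373` ((3.73), typers' record
`BalabanJaffe1986.BJ86CouplingRenormalization`) in the two coefficient lemmas of §2.

WHY (ENCLOSURE-MAP v1 row E10, CITATION-FIT R2-F15).  Erice (3.76) p. 250 «1/g₀² = 1/g² − β₀ log_L ε^{−1} − β₁ log_L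
log_L ε^{−1} + O(1)» is typed as `BareCouplingAsymptotics376` and had NO producer and NO consumer in the tree.  Its O(1)
silently uses, with `g_n² ≈ 1/(|β₀|(K − n))` (R2-F15): (i) the n-UNIFORM O of (3.73); (ii) `Σ_{n<K} (β_{n,0} − β₀) = O(1)`
(the one-loop DRIFT `Drift.OneLoopDrift`, NOT the termwise (3.75)); (iii) `Σ_{n<K} |β_{n,2} − β₂|/(K − n) = O(1)`.  The three
files PROVE (3.76) from the typed shapes + (i)–(iii).  The sums that carry the proof are collected here, in the letters
`K − j` = distance to the unit-lattice end (`j < K`):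
* §1 (S1)/(S2) `Σ 1/(K − j)²` and its tails (telescoping, constant 2); (S3) the exchange of summation over `j ≤ i < K` that
  makes the two-loop COMPARISON `Σ_j |g_j² − 1/(1/g² + |β₀|(K − j))|` converge WITHOUT logarithms; (S4) the logarithmic
  sandwich `Σ_{j<K} 1/(a + c(K − j)) = (log K)/c + O(1)` with explicit constants — the source of «β₁ log_L log_L ε^{−1}»;
  the growth lemma `ηK ≤ P + Q log K ∀K ⟹ η ≤ 0`.
* §2 what (3.73) + (iii) give coefficient-wise: `C ≥ 0`, `|β_{n,2} − β₂| ≤ A′`, `A′ ≥ 0`, and the step deviation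
  `|β_n(t) − β_{n,0}| ≤ (|β₂| + A′ + C s₀)·t` on `0 ≤ t ≤ s₀`.
NOT CLAIMED: anything about Bałaban's `β_{k+1}` of [I] (1.22); any value of β₀, β₂; `BetaPertH`; continuum; Clay.
-/

namespace Summit.QuantumFields.BalabanUV.Beta.EriceFlowEnclosureBareSums

open Literature.MathematicalPhysics.QuantumFieldTheory.BalabanJaffe1986.BJ86CouplingRenormalization

noncomputable section

/-! ## §1 Four summation lemmas in distance-to-the-unit-lattice letters, and a growth lemma -/

/-- **(S2) Tail of `Σ 1/m²` in distance-to-the-unit-lattice letters.**  For `i < K`: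
`Σ_{j ≤ i} 1/(K − j)² ≤ 2/(K − i)` — telescoping against `1/(K − j − ½) − 1/(K − j + ½) = 1/((K − j)² − ¼)`. -/
theorem sum_inv_sq_dist_le {K i : ℕ} (hi : i < K) :
    ∑ j ∈ Finset.range (i + 1), 1 / ((K : ℝ) - j) ^ 2 ≤ 2 / ((K : ℝ) - i) := by
  set F : ℕ → ℝ := fun j => 1 / ((K : ℝ) - j + 1 / 2) with hF
  have hiK : (i : ℝ) + 1 ≤ K := by exact_mod_cast hi
  have hle : ∑ j ∈ Finset.range (i + 1), 1 / ((K : ℝ) - j) ^ 2 ≤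
      ∑ j ∈ Finset.range (i + 1), (F (j + 1) - F j) := by
    refine Finset.sum_le_sum fun j hj => ?_
    have hj : (j : ℝ) ≤ i := by exact_mod_cast Nat.lt_succ_iff.mp (Finset.mem_range.mp hj)
    have hd : (1 : ℝ) ≤ (K : ℝ) - j := by linarith
    have h1 : (K : ℝ) - j + 1 / 2 ≠ 0 := ne_of_gt (by linarith)
    have h2 : (K : ℝ) - (j + 1) + 1 / 2 ≠ 0 := ne_of_gt (by linarith)
    have h3 : ((K : ℝ) - j) ^ 2 - 1 / 4 ≠ 0 := ne_of_gt (by nlinarith)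
    have hFj : F (j + 1) - F j = 1 / (((K : ℝ) - j) ^ 2 - 1 / 4) := by
      simp only [hF, Nat.cast_add, Nat.cast_one]
      rw [div_sub_div _ _ h2 h1, div_eq_div_iff (mul_ne_zero h2 h1) h3]
      ring
    rw [hFj]
    exact one_div_le_one_div_of_le (by nlinarith) (by linarith)
  refine hle.trans ?_
  rw [Finset.sum_range_sub]
  simp only [hF, Nat.cast_add, Nat.cast_one, Nat.cast_zero, sub_zero]
  have h1 : 0 < 1 / ((K : ℝ) + 1 / 2) := by positivity
  have h2 : 1 / ((K : ℝ) - (i + 1) + 1 / 2) ≤ 2 / ((K : ℝ) - i) := by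
    rw [div_le_div_iff₀ (by linarith) (by linarith)]
    linarith
  linarith

/-- **(S1)** `Σ_{j<K} 1/(K − j)² ≤ 2` for every `K` ((S2) at `i = K − 1`). -/
theorem sum_inv_sq_dist_le_two (K : ℕ) :
    ∑ j ∈ Finset.range K, 1 / ((K : ℝ) - j) ^ 2 ≤ 2 := by
  cases K with
  | zero => simp
  | succ k =>
    have h := sum_inv_sq_dist_le (K := k + 1) (i := k) (Nat.lt_succ_self k)
    have hk : ((k + 1 : ℕ) : ℝ) - k = 1 := by push_cast; ring
    rw [hk] at h
    linarith

/-- **(S3) Exchange of summation over the triangle `j ≤ i < K`**: `Σ_{j<K} v_j Σ_{i∈[j,K)} u_i = Σ_{i<K} u_i Σ_{j≤i} v_j`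
(`Finset.sum_comm'`).  This is what removes every logarithm from the two-loop COMPARISON sum. -/
theorem sum_range_mul_sum_Ico_comm (u v : ℕ → ℝ) (K : ℕ) :
    ∑ j ∈ Finset.range K, v j * ∑ i ∈ Finset.Ico j K, u i =
      ∑ i ∈ Finset.range K, u i * ∑ j ∈ Finset.range (i + 1), v j := by
  simp_rw [Finset.mul_sum]
  rw [Finset.sum_comm' (t' := Finset.range K) (s' := fun i => Finset.range (i + 1))]
  · refine Finset.sum_congr rfl fun i _ => Finset.sum_congr rfl fun j _ => mul_comm _ _
  · intro j i
    simp only [Finset.mem_range, Finset.mem_Ico]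
    omega

/-- **(S4) The logarithmic sandwich for the one-loop model sum**, `a, c > 0`, every `K`:
`(log K − log(1 + a/c))/c ≤ Σ_{j<K} 1/(a + c(K − j)) ≤ (log K + log(1 + c/a))/c` — telescoping `log(a (+c) + c(K − j))`
against `t/(1 + t) ≤ log(1 + t) ≤ t` (`Real.one_sub_inv_le_log_of_pos`, `Real.log_le_sub_one_of_pos`); at `K = 0` both
sides hold with `log 0 = 0`.  This is where `log K = log_L log_L ε^{−1} · log L` of (3.76) comes from. -/
theorem log_sandwich_sum_inv_affine {a c : ℝ} (ha : 0 < a) (hc : 0 < c) (K : ℕ) :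
    (Real.log K - Real.log (1 + a / c)) / c ≤ ∑ j ∈ Finset.range K, 1 / (a + c * ((K : ℝ) - j)) ∧
      ∑ j ∈ Finset.range K, 1 / (a + c * ((K : ℝ) - j)) ≤ (Real.log K + Real.log (1 + c / a)) / c := by
  rcases Nat.eq_zero_or_pos K with hK | hK
  · subst hK
    simp only [Nat.cast_zero, Real.log_zero, zero_sub, Finset.range_zero, Finset.sum_empty, zero_add]
    constructor
    · have : 0 ≤ Real.log (1 + a / c) := Real.log_nonneg (by have := div_pos ha hc; linarith)
      exact div_nonpos_of_nonpos_of_nonneg (by linarith) hc.le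
    · have : 0 ≤ Real.log (1 + c / a) := Real.log_nonneg (by have := div_pos hc ha; linarith)
      positivity
  have hK1 : (1 : ℝ) ≤ K := by exact_mod_cast hK
  constructor
  · -- lower bound: G j := -(1/c) log (a + c + c (K - j)); term ≥ G (j+1) - G j
    set G : ℕ → ℝ := fun j => -(Real.log (a + c + c * ((K : ℝ) - j))) / c with hG
    have hle : ∑ j ∈ Finset.range K, (G (j + 1) - G j) ≤ ∑ j ∈ Finset.range K, 1 / (a + c * ((K : ℝ) - j)) := by
      refine Finset.sum_le_sum fun j hj => ?_
      have hj : (j : ℝ) + 1 ≤ K := by exact_mod_cast Finset.mem_range.mp hj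
      have hu : 0 < a + c * ((K : ℝ) - j) := by nlinarith
      have hu' : 0 < a + c + c * ((K : ℝ) - (j + 1)) := by nlinarith
      -- G (j+1) - G j = (1/c) * log ((a + c + c(K-j)) / (a + c + c (K - j - 1))) = (1/c) log (1 + c/u), u = a + c(K-j)
      have hGj : G (j + 1) - G j = Real.log ((a + c + c * ((K : ℝ) - j)) / (a + c * ((K : ℝ) - j))) / c := by
        simp only [hG, Nat.cast_add, Nat.cast_one]
        have e1 : a + c + c * ((K : ℝ) - (j + 1)) = a + c * ((K : ℝ) - j) := by ring
        rw [e1, Real.log_div (ne_of_gt (by nlinarith)) (ne_of_gt hu)]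
        ring
      rw [hGj, div_le_iff₀ hc]
      have hw : 0 < a + c + c * ((K : ℝ) - j) := by nlinarith
      have hx : 0 < (a + c + c * ((K : ℝ) - j)) / (a + c * ((K : ℝ) - j)) := div_pos hw hu
      have := Real.log_le_sub_one_of_pos hx
      have e2 : (a + c + c * ((K : ℝ) - j)) / (a + c * ((K : ℝ) - j)) - 1 = c / (a + c * ((K : ℝ) - j)) := by
        field_simp
        ring
      rw [e2] at this
      calc Real.log ((a + c + c * ((K : ℝ) - j)) / (a + c * ((K : ℝ) - j)))
          ≤ c / (a + c * ((K : ℝ) - j)) := this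
        _ = 1 / (a + c * ((K : ℝ) - j)) * c := by ring
    refine le_trans ?_ hle
    rw [Finset.sum_range_sub]
    simp only [hG, Nat.cast_zero, sub_zero, sub_self, mul_zero, add_zero]
    -- goal: (log K - log (1 + a/c)) / c ≤ -log (a + c) / c - (-log (a + c + c K) / c)
    have hac : 0 < a + c := by linarith
    have e3 : -Real.log (a + c) / c - -Real.log (a + c + c * (K : ℝ)) / c =
        Real.log ((a + c + c * (K : ℝ)) / (a + c)) / c := by
      rw [Real.log_div (ne_of_gt (by nlinarith)) (ne_of_gt hac)]
      ring
    rw [e3, div_le_div_iff_of_pos_right hc]  -- hmm name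
    have e4 : Real.log K - Real.log (1 + a / c) = Real.log ((K : ℝ) / (1 + a / c)) := by
      rw [Real.log_div (ne_of_gt (by linarith)) (ne_of_gt (by have := div_pos ha hc; linarith))]
    rw [e4]
    refine Real.log_le_log (div_pos (by linarith) (by have := div_pos ha hc; linarith)) ?_
    rw [div_le_div_iff₀ (by have := div_pos ha hc; linarith) hac]
    have e5 : (K : ℝ) * (a + c) = (c * (K : ℝ)) * (1 + a / c) := by field_simp; ring
    rw [e5]
    have : 0 < 1 + a / c := by have := div_pos ha hc; linarith
    nlinarith
  · -- upper bound: G j := -(1/c) log (a + c (K - j)); term ≤ G (j+1) - G j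
    set G : ℕ → ℝ := fun j => -(Real.log (a + c * ((K : ℝ) - j))) / c with hG
    have hle : ∑ j ∈ Finset.range K, 1 / (a + c * ((K : ℝ) - j)) ≤ ∑ j ∈ Finset.range K, (G (j + 1) - G j) := by
      refine Finset.sum_le_sum fun j hj => ?_
      have hj : (j : ℝ) + 1 ≤ K := by exact_mod_cast Finset.mem_range.mp hj
      have hu : 0 < a + c * ((K : ℝ) - (j + 1)) := by nlinarith
      have hv : 0 < a + c * ((K : ℝ) - j) := by nlinarith
      have hGj : G (j + 1) - G j = Real.log ((a + c * ((K : ℝ) - j)) / (a + c * ((K : ℝ) - (j + 1)))) / c := by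
        simp only [hG, Nat.cast_add, Nat.cast_one]
        rw [Real.log_div (ne_of_gt hv) (ne_of_gt hu)]
        ring
      rw [hGj, le_div_iff₀ hc]
      have hx : 0 < (a + c * ((K : ℝ) - j)) / (a + c * ((K : ℝ) - (j + 1))) := div_pos hv hu
      have := Real.one_sub_inv_le_log_of_pos hx
      have e2 : 1 - ((a + c * ((K : ℝ) - j)) / (a + c * ((K : ℝ) - (j + 1))))⁻¹ = c / (a + c * ((K : ℝ) - j)) := by
        rw [inv_div]
        field_simp
        ring
      rw [e2] at this
      calc 1 / (a + c * ((K : ℝ) - j)) * c = c / (a + c * ((K : ℝ) - j)) := by ring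
        _ ≤ _ := this
    refine hle.trans ?_
    rw [Finset.sum_range_sub]
    simp only [hG, Nat.cast_zero, sub_zero, sub_self, mul_zero, add_zero]
    have e3 : -Real.log a / c - -Real.log (a + c * (K : ℝ)) / c = Real.log ((a + c * (K : ℝ)) / a) / c := by
      rw [Real.log_div (ne_of_gt (by nlinarith)) (ne_of_gt ha)]
      ring
    rw [e3, div_le_div_iff_of_pos_right hc]
    have e4 : Real.log K + Real.log (1 + c / a) = Real.log ((K : ℝ) * (1 + c / a)) := by
      rw [Real.log_mul (ne_of_gt (by linarith)) (ne_of_gt (by have := div_pos hc ha; linarith))]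
    rw [e4]
    refine Real.log_le_log (div_pos (by nlinarith) ha) ?_
    rw [div_le_iff₀ ha]
    have e5 : (K : ℝ) * (1 + c / a) * a = (K : ℝ) * (a + c) := by field_simp
    rw [e5]
    nlinarith



/-- **Growth lemma**: a linear function with positive slope is not dominated by `P + Q log K` on the naturals (`Q ≥ 0`)
— `log K ≤ log M + K/M − 1` with `M = 2Q/η + 1`, then Archimedes.  Used to FORCE the sign of `β₀` (§3 of
`EriceFlowEnclosureBareAsymptotics`). -/
theorem not_linear_le_log {η P Q : ℝ} (hη : 0 < η) (hQ : 0 ≤ Q)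
    (h : ∀ K : ℕ, 1 ≤ K → η * K ≤ P + Q * Real.log K) : False := by
  -- log K ≤ log M + K/M - 1 with M = 2Q/η + 1
  set M : ℝ := 2 * Q / η + 1 with hM
  have hMpos : 0 < M := by
    have h0 : 0 ≤ 2 * Q / η := by positivity
    linarith
  have hQM : Q / M ≤ η / 2 := by
    rw [div_le_iff₀ hMpos, hM]
    have e : η / 2 * (2 * Q / η + 1) = Q + η / 2 := by field_simp
    rw [e]; linarith
  set P' : ℝ := P + Q * Real.log M with hP'
  have hbound : ∀ K : ℕ, 1 ≤ K → η / 2 * K ≤ P' := by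
    intro K hK
    have hK' : (0 : ℝ) < K := by exact_mod_cast hK
    have hlog : Real.log K ≤ Real.log M + ((K : ℝ) / M - 1) := by
      have h1 : Real.log K = Real.log ((K : ℝ) / M) + Real.log M := by
        rw [Real.log_div (ne_of_gt hK') (ne_of_gt hMpos)]; ring
      have h2 := Real.log_le_sub_one_of_pos (div_pos hK' hMpos)
      linarith
    have h3 := h K hK
    have h4 : Q * Real.log K ≤ Q * Real.log M + Q / M * K - Q := by
      have := mul_le_mul_of_nonneg_left hlog hQ
      have e : Q * (Real.log M + ((K : ℝ) / M - 1)) = Q * Real.log M + Q / M * K - Q := by ring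
      linarith
    have h5 : Q / M * K ≤ η / 2 * K := mul_le_mul_of_nonneg_right hQM hK'.le
    rw [hP']
    nlinarith
  obtain ⟨K, hK⟩ := exists_nat_gt (2 * |P'| / η + 1)
  have hK1 : 1 ≤ K := by
    have : (1 : ℝ) < K := by
      have : 0 ≤ 2 * |P'| / η := by positivity
      linarith
    exact_mod_cast this.le
  have h6 := hbound K hK1
  have h7 : η / 2 * K > |P'| := by
    have e : η / 2 * (2 * |P'| / η + 1) = |P'| + η / 2 := by field_simp
    nlinarith
  have := le_abs_self P'
  linarith


/-! ## §2 What the Taylor shape (3.73) and the two-loop log-rate (iii) give coefficient-wise -/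

section Coefficients

variable {βE : ℕ → ℝ → ℝ} {β₀seq β₂seq : ℕ → ℝ} {C s₀ β₂ A' : ℝ}

/-- From hypothesis (iii) at `K = n + 1`: every two-loop coefficient is within `A'` of `β₂`. -/
theorem abs_beta2seq_sub_le (hiii : ∀ K : ℕ, ∑ n ∈ Finset.range K, |β₂seq n - β₂| / ((K : ℝ) - n) ≤ A')
    (n : ℕ) : |β₂seq n - β₂| ≤ A' := by
  have h := hiii (n + 1)
  have hsingle : |β₂seq n - β₂| / (((n + 1 : ℕ) : ℝ) - n) ≤
      ∑ j ∈ Finset.range (n + 1), |β₂seq j - β₂| / (((n + 1 : ℕ) : ℝ) - j) := by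
    refine Finset.single_le_sum (f := fun j => |β₂seq j - β₂| / (((n + 1 : ℕ) : ℝ) - j)) ?_
      (Finset.self_mem_range_succ n)
    intro j hj
    have : (j : ℝ) < n + 1 := by exact_mod_cast Finset.mem_range.mp hj
    push_cast
    exact div_nonneg (abs_nonneg _) (by linarith)
  have e : (((n + 1 : ℕ) : ℝ) - n) = 1 := by push_cast; ring
  rw [e, div_one] at hsingle
  exact hsingle.trans h

/-- Hypothesis (iii) forces `0 ≤ A'` (empty sum). -/
theorem twoLoopRate_nonneg (hiii : ∀ K : ℕ, ∑ n ∈ Finset.range K, |β₂seq n - β₂| / ((K : ℝ) - n) ≤ A') :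
    0 ≤ A' := by
  simpa using hiii 0

/-- The Taylor remainder constant is nonnegative as soon as the shape is used at one positive point. -/
theorem taylorConst_nonneg (h373 : TaylorSplit373 βE β₀seq β₂seq C s₀) {t : ℝ} (ht : 0 < t) (hts : t ≤ s₀) :
    0 ≤ C := by
  have h := h373 0 t ht.le hts
  have h2 : 0 ≤ C * t ^ 2 := (abs_nonneg _).trans h
  rcases le_or_gt 0 C with hC | hC
  · exact hC
  · have : C * t ^ 2 < 0 := mul_neg_of_neg_of_pos hC (by positivity)
    linarith

/-- The step deviation from the one-loop coefficient along the run: `|β_j(g_j²) − β_{j,0}| ≤ (|β₂| + A' + C s₀)·g_j²`. -/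
theorem abs_step_sub_beta0seq_le (h373 : TaylorSplit373 βE β₀seq β₂seq C s₀) (hC : 0 ≤ C)
    (hiii : ∀ K : ℕ, ∑ n ∈ Finset.range K, |β₂seq n - β₂| / ((K : ℝ) - n) ≤ A')
    {t : ℝ} (ht : 0 ≤ t) (hts : t ≤ s₀) (j : ℕ) :
    |βE j t - β₀seq j| ≤ (|β₂| + A' + C * s₀) * t := by
  have h1 := h373 j t ht hts
  have h2 : |β₂seq j| ≤ |β₂| + A' := by
    have := abs_beta2seq_sub_le hiii j
    have e : β₂seq j = β₂ + (β₂seq j - β₂) := by ring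
    rw [e]
    exact (abs_add_le _ _).trans (by linarith)
  have h3 : |β₂seq j * t| ≤ (|β₂| + A') * t := by
    rw [abs_mul, abs_of_nonneg ht]
    exact mul_le_mul_of_nonneg_right h2 ht
  have h4 : C * t ^ 2 ≤ C * s₀ * t := by
    have : t ^ 2 ≤ s₀ * t := by nlinarith
    nlinarith
  have e : βE j t - β₀seq j = (βE j t - (β₀seq j + β₂seq j * t)) + β₂seq j * t := by ring
  rw [e]
  refine (abs_add_le _ _).trans ?_
  nlinarith


end Coefficients

end

end Summit.QuantumFields.BalabanUV.Beta.EriceFlowEnclosureBareSums
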